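import Mathlib
import Literature.Analysis.SpecialFunctions.Erf
import Literature.ComputerArithmetic.BrentZimmermann2010.ErfSeries
import Literature.ComputerArithmetic.BrentZimmermann2010.AsymptoticExpansions
import HarnessLib

/-!
# The Takahasi–Mori variable transformations: the erf rules and the DE map `exp (u - e^{-u})` (Davis–Rabinowitz, Sect. 3.4.5)

**Statement.** The changes of variable behind the "rules of Takahasi and Mori" of P. J. Davis, P. Rabinowitz,
*Methods of Numerical Integration* (2nd ed., 1984), Sect. 3.4.5, (3.4.5.7)–(3.4.5.9) and (3.4.5.13), stated
as identities that hold for EVERY `f : ℝ → ℝ` (no continuity, decay or integrability hypothesis: both sides are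
Lebesgue integrals and integrability transfers along an injective `C¹` substitution,
`MeasureTheory.integral_image_eq_integral_abs_deriv_smul`; when one side diverges both are the junk value `0`):

* the error function `erf u = (2/√π) ∫₀ᵘ e^{-t²} dt` (3.4.5.7) as a change of variables of `ℝ` onto `(-1, 1)`:
  `erf' = (2/√π) e^{-u²}` (`hasDerivAt_erf`), `erf (-u) = -erf u`, `-1 < erf < 1`, strict monotonicity, the limits
  `∓1` at `∓∞` and `erf '' ℝ = (-1, 1)` (`image_erf_univ`);
* the **erf rule substitution** (3.4.5.8): `∫ x in -1..1, f x = (2/√π) ∫ u, e^{-u²} f (erf u)`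
  (`integral_erf_substitution`), with the integrability transfer `integrableOn_Ioo_iff_integrable_erf_substitution`;
* its half-line form (3.4.5.9), `x = log (2/(1 - erf u))`:
  `∫ x in Ioi 0, f x = (2/√π) ∫ u, e^{-u²}/(1 - erf u) · f (log (2/(1 - erf u)))` (`integral_Ioi_erf_substitution`),
  through the map `y ↦ log (2/(1-y))` of `(-1, 1)` onto `(0, ∞)` (`integral_Ioi_substitution_log_two_div_one_sub`);
* the DE map for integrands `f₁(x) e^{-x}` (3.4.5.13), `w = exp (u - e^{-u})`:
  `∫ x in Ioi 0, f x = ∫ u, (1 + e^{-u}) w(u) f (w u)` (`integral_Ioi_halfLineDE_substitution`).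

**Why here.** Read left to right these maps turn an integral with end-point singularities into a rapidly decaying
whole-line integrand for the trapezoidal rule (convergence `exp(-c N^{2/3})` for the erf rules, `exp(-c N/log N)` for
the DE rules); read right to left they let a BOX certificate on `[-1, 1]` certify a Gaussian-weighted whole-line
integral. Prior art in the tree (USED or cited, not restated): `Literature.Analysis.SpecialFunctions.erf` (the
definition, DLMF 7.2.1, with its Maclaurin series), `…BrentZimmermann2010.AsymptoticExpansions.erfc_pos` /
`erfc_eq_integral` and `…ErfSeries.integral_exp_neg_sq_neg` (used for the bounds and the oddness); the tanh–sinh map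
(3.4.5.10) with its discretisation error is `Literature.Analysis.Quadrature.TanhSinhTransformation`, and the one-step
maps `x = eᵘ`, `x = sinh u`, `x = tanh u` together with the DE maps (3.4.5.11) `x = exp (π/2 · sinh u)` and (3.4.5.12)
`x = sinh (π/2 · sinh u)` are `Literature.MeasureTheory.Integral.WholeAxisSubstitution`
(`integral_exp_sinh_substitution`, `integral_sinh_sinh_substitution`). The
derivative and the bound `erf < 1` are also proved summit-side in
`Summits/Ventures/LatticeQCDFlow/Scaling/SwapSpacingOptimum.lean`, which a Literature file cannot import.
The trapezoidal sums and error terms `E_h f` of (3.4.5.8)–(3.4.5.9) are not formalised here.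

**Engine.** Mathlib: `MeasureTheory.integral_image_eq_integral_abs_deriv_smul`,
`MeasureTheory.integrableOn_image_iff_integrableOn_abs_deriv_smul`, `Continuous.integral_hasStrictDerivAt`,
`MeasureTheory.intervalIntegral_tendsto_integral_Ioi`, `integral_gaussian_Ioi`, `mem_range_of_exists_le_of_exists_ge`,
`Continuous.surjective`, `strictMono_of_deriv_pos`.

References: P. J. Davis, P. Rabinowitz, Methods of Numerical Integration, 2nd ed., Academic Press 1984, Sect. 3.4.5,
(3.4.5.7)–(3.4.5.9), (3.4.5.13) (bib key `DavisRabinowitz1984`); H. Takahasi, M. Mori, Double exponential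
formulas for numerical integration, Publ. RIMS 9 (1974) 721–741 (bib key `TakahasiMori1974`); NIST DLMF §7.2(i),
§7.4 (bib key `DLMF`). Standard axioms only.
-/

open _root_.MeasureTheory Set Filter Real
open scoped Topology
open Literature.Analysis.SpecialFunctions (erf)
open Literature.ComputerArithmetic.BrentZimmermann2010

noncomputable section

namespace Literature.MeasureTheory.Integral

/-! ### The error function as a change of variables (3.4.5.7) -/

/-- `erf' u = (2/√π) e^{-u²}`. [cite: DLMF, §7.2(i) eq. 7.2.1] [cite: DavisRabinowitz1984, Sect. 3.4.5 (3.4.5.7)] -/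
theorem hasDerivAt_erf (u : ℝ) : HasDerivAt erf (2 / √π * exp (-u ^ 2)) u := by
  have hc : Continuous fun t : ℝ => exp (-(t ^ 2)) := by fun_prop
  exact ((hc.integral_hasStrictDerivAt 0 u).hasDerivAt).const_mul (2 / √π)

/-- `deriv erf u = (2/√π) e^{-u²}`. [cite: DLMF, §7.2(i) eq. 7.2.1] -/
theorem deriv_erf (u : ℝ) : deriv erf u = 2 / √π * exp (-u ^ 2) := (hasDerivAt_erf u).deriv

/-- `erf` is continuous (proved summit-side too, `Summit.Ventures.LatticeQCDFlow.Scaling.continuous_erf`, which a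
Literature file cannot import; this is the upstream copy). [cite: DLMF, §7.2(i) eq. 7.2.1] -/
theorem continuous_erf : Continuous erf :=
  continuous_iff_continuousAt.mpr fun u => (hasDerivAt_erf u).continuousAt

/-- `erf` is odd: `erf (-u) = -erf u`. [cite: DLMF, §7.4 eq. 7.4.1] -/
theorem erf_neg (u : ℝ) : erf (-u) = -erf u := by
  simp only [Literature.Analysis.SpecialFunctions.erf, ErfSeries.integral_exp_neg_sq_neg u, mul_neg]

/-- `erf u < 1` for every real `u` (the Gaussian tail is positive; proved summit-side too,
`Summit.Ventures.LatticeQCDFlow.Scaling.erf_lt_one`, not importable here). [cite: DLMF, §7.2(i) eq. 7.2.1-7.2.2] -/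
theorem erf_lt_one (u : ℝ) : erf u < 1 := by
  have h := AsymptoticExpansions.erfc_pos u
  unfold AsymptoticExpansions.erfc at h
  linarith

/-- `-1 < erf u` for every real `u`. [cite: DLMF, §7.2(i) eq. 7.2.1-7.2.2] -/
theorem neg_one_lt_erf (u : ℝ) : -1 < erf u := by
  have h := erf_lt_one (-u)
  rw [erf_neg] at h
  linarith

/-- `erf u ∈ (-1, 1)`. [cite: DLMF, §7.2(i) eq. 7.2.1-7.2.2] -/
theorem erf_mem_Ioo (u : ℝ) : erf u ∈ Ioo (-1:ℝ) 1 := ⟨neg_one_lt_erf u, erf_lt_one u⟩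

/-- `erf` is strictly increasing (summit-side twin: `Summit.Ventures.PQCStructure.Dist.MethodsPowerQuantiles.erf_strictMono`,
not importable here). [cite: DLMF, §7.2(i) eq. 7.2.1] -/
theorem strictMono_erf : StrictMono erf :=
  strictMono_of_deriv_pos fun u => by rw [deriv_erf]; positivity

/-- `erf` is injective. [cite: DLMF, §7.2(i) eq. 7.2.1] -/
theorem erf_injective : Function.Injective erf := strictMono_erf.injective

/-- `erf u → 1` as `u → +∞` (`∫₀^∞ e^{-t²} dt = √π/2`). [cite: DLMF, §7.2(i) eq. 7.2.1-7.2.2] -/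
theorem tendsto_erf_atTop : Tendsto erf atTop (𝓝 1) := by
  have hint : Integrable fun t : ℝ => exp (-(t ^ 2)) := by
    simpa using integrable_exp_neg_mul_sq (b := 1) one_pos
  have hIoi : ∫ t in Ioi (0:ℝ), exp (-(t ^ 2)) = √π / 2 := by
    have h := integral_gaussian_Ioi (1 : ℝ)
    simp only [neg_mul, one_mul, div_one] at h
    exact h
  have h := (intervalIntegral_tendsto_integral_Ioi 0 hint.integrableOn tendsto_id).const_mul (2 / √π)
  rw [hIoi] at h
  have hpi : √π ≠ 0 := by positivity
  have h1 : 2 / √π * (√π / 2) = 1 := by field_simp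
  rw [h1] at h
  exact h.congr fun u => rfl

/-- `erf u → -1` as `u → -∞`. [cite: DLMF, §7.2(i) eq. 7.2.1-7.2.2] -/
theorem tendsto_erf_atBot : Tendsto erf atBot (𝓝 (-1)) := by
  have h : Tendsto (fun u => -erf (-u)) atBot (𝓝 (-1)) := (tendsto_erf_atTop.comp tendsto_neg_atBot_atTop).neg
  refine h.congr fun u => ?_
  rw [erf_neg, neg_neg]

/-- The range of `erf` is the open interval `(-1, 1)`. [cite: DLMF, §7.2(i) eq. 7.2.1-7.2.2]
[cite: DavisRabinowitz1984, Sect. 3.4.5 (3.4.5.7)-(3.4.5.8)] -/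
theorem range_erf : range erf = Ioo (-1:ℝ) 1 := by
  refine Subset.antisymm (range_subset_iff.mpr erf_mem_Ioo) fun y hy => ?_
  refine mem_range_of_exists_le_of_exists_ge continuous_erf ?_ ?_
  · obtain ⟨a, ha⟩ := (tendsto_erf_atBot.eventually (gt_mem_nhds hy.1)).exists
    exact ⟨a, ha.le⟩
  · obtain ⟨b, hb⟩ := (tendsto_erf_atTop.eventually (lt_mem_nhds hy.2)).exists
    exact ⟨b, hb.le⟩

/-- `erf` maps the whole axis onto `(-1, 1)`. [cite: DavisRabinowitz1984, Sect. 3.4.5 (3.4.5.7)-(3.4.5.8)] -/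
theorem image_erf_univ : erf '' (univ : Set ℝ) = Ioo (-1:ℝ) 1 := by rw [image_univ, range_erf]

/-! ### The erf rule substitution (3.4.5.8) and its half-line form (3.4.5.9) -/

/-- **The erf-rule substitution** `x = erf u` (3.4.5.8): for every `f`,
`∫ x in -1..1, f x = (2/√π) ∫ u, e^{-u²} f (erf u)`. [cite: DavisRabinowitz1984, Sect. 3.4.5 (3.4.5.8)] -/
theorem integral_erf_substitution (f : ℝ → ℝ) :
    ∫ x in (-1:ℝ)..1, f x = 2 / √π * ∫ u, exp (-u ^ 2) * f (erf u) := by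
  have h := integral_image_eq_integral_abs_deriv_smul (s := (univ : Set ℝ)) (f := erf)
    (f' := fun u => 2 / √π * exp (-u ^ 2)) MeasurableSet.univ (fun u _ => (hasDerivAt_erf u).hasDerivWithinAt)
    erf_injective.injOn f
  rw [image_erf_univ, setIntegral_univ] at h
  rw [intervalIntegral.integral_of_le (by norm_num), integral_Ioc_eq_integral_Ioo, h, ← integral_const_mul]
  refine integral_congr_ae (ae_of_all _ fun u => ?_)
  beta_reduce
  rw [smul_eq_mul, abs_of_pos (by positivity)]
  ring

/-- Integrability transfers along (3.4.5.8): `f` is integrable on `(-1, 1)` iff `u ↦ e^{-u²} f (erf u)` is integrable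
on `ℝ`. [cite: DavisRabinowitz1984, Sect. 3.4.5 (3.4.5.8)] -/
theorem integrableOn_Ioo_iff_integrable_erf_substitution (f : ℝ → ℝ) :
    IntegrableOn f (Ioo (-1:ℝ) 1) ↔ Integrable fun u => exp (-u ^ 2) * f (erf u) := by
  have h := integrableOn_image_iff_integrableOn_abs_deriv_smul (s := (univ : Set ℝ)) (f := erf)
    (f' := fun u => 2 / √π * exp (-u ^ 2)) MeasurableSet.univ (fun u _ => (hasDerivAt_erf u).hasDerivWithinAt)
    erf_injective.injOn f
  rw [image_erf_univ, integrableOn_univ] at h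
  rw [h]
  have h2 : (fun u => |2 / √π * exp (-u ^ 2)| • f (erf u)) = fun u => (2 / √π) * (exp (-u ^ 2) * f (erf u)) := by
    funext u
    rw [smul_eq_mul, abs_of_pos (by positivity)]
    ring
  rw [h2, integrable_const_mul_iff (isUnit_iff_ne_zero.mpr (by positivity)) _]

/-- The map `y ↦ log (2/(1-y))` carries `(-1, 1)` onto `(0, ∞)` (inverse `y = 1 - 2e^{-x}`).
[cite: DavisRabinowitz1984, Sect. 3.4.5 (3.4.5.9)] -/
theorem image_log_two_div_one_sub_Ioo : (fun y : ℝ => log (2 / (1 - y))) '' Ioo (-1:ℝ) 1 = Ioi 0 := by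
  ext x
  simp only [mem_image, mem_Ioo, mem_Ioi]
  constructor
  · rintro ⟨y, ⟨hy1, hy2⟩, rfl⟩
    have h1 : 0 < 1 - y := by linarith
    exact log_pos ((one_lt_div h1).mpr (by linarith))
  · intro hx
    refine ⟨1 - 2 * exp (-x), ⟨?_, ?_⟩, ?_⟩
    · have : exp (-x) < 1 := exp_lt_one_iff.mpr (by linarith)
      linarith
    · have := exp_pos (-x)
      linarith
    · have h : (2:ℝ) / (1 - (1 - 2 * exp (-x))) = exp x := by
        rw [exp_neg]
        have := exp_pos x
        field_simp
        ring
      rw [h, log_exp]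

/-- **The half line onto `(-1, 1)`**, `x = log (2/(1-y))` (the outer map of (3.4.5.9)): for every `f`,
`∫ x in Ioi 0, f x = ∫ y in -1..1, f (log (2/(1-y))) / (1-y)`. [cite: DavisRabinowitz1984, Sect. 3.4.5 (3.4.5.9)] -/
theorem integral_Ioi_substitution_log_two_div_one_sub (f : ℝ → ℝ) :
    ∫ x in Ioi 0, f x = ∫ y in (-1:ℝ)..1, f (log (2 / (1 - y))) / (1 - y) := by
  have hder : ∀ y ∈ Ioo (-1:ℝ) 1,
      HasDerivWithinAt (fun y : ℝ => log (2 / (1 - y))) (1 / (1 - y)) (Ioo (-1:ℝ) 1) y := by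
    intro y hy
    have h1 : (1 - y) ≠ 0 := by linarith [hy.2]
    have h2 : (2:ℝ) / (1 - y) ≠ 0 := div_ne_zero two_ne_zero h1
    have h := ((hasDerivAt_const y (2:ℝ)).div ((hasDerivAt_const y (1:ℝ)).sub (hasDerivAt_id y)) h1).log h2
    refine (h.congr_deriv ?_).hasDerivWithinAt
    simp only [id, Pi.sub_apply, Pi.div_apply]
    field_simp
    ring
  have hinj : (Ioo (-1:ℝ) 1).InjOn (fun y : ℝ => log (2 / (1 - y))) := by
    intro y hy z hz hyz
    have h1 : 0 < 1 - y := by linarith [hy.2]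
    have h2 : 0 < 1 - z := by linarith [hz.2]
    have h := log_injOn_pos (mem_Ioi.mpr (by positivity : (0:ℝ) < 2 / (1 - y)))
      (mem_Ioi.mpr (by positivity : (0:ℝ) < 2 / (1 - z))) hyz
    rw [div_eq_div_iff h1.ne' h2.ne'] at h
    linarith
  have h := integral_image_eq_integral_abs_deriv_smul (s := Ioo (-1:ℝ) 1) (f := fun y : ℝ => log (2 / (1 - y)))
    (f' := fun y => 1 / (1 - y)) measurableSet_Ioo hder hinj f
  rw [image_log_two_div_one_sub_Ioo] at h
  rw [intervalIntegral.integral_of_le (by norm_num), integral_Ioc_eq_integral_Ioo, h]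
  refine setIntegral_congr_fun measurableSet_Ioo fun y hy => ?_
  have h1 : 0 < 1 - y := by linarith [hy.2]
  rw [abs_of_pos (by positivity), smul_eq_mul, one_div, inv_mul_eq_div]

/-- **The erf half-line substitution** `x = log (2/(1 - erf u))` (3.4.5.9): for every `f`,
`∫ x in Ioi 0, f x = (2/√π) ∫ u, e^{-u²}/(1 - erf u) · f (log (2/(1 - erf u)))`.
[cite: DavisRabinowitz1984, Sect. 3.4.5 (3.4.5.9)] -/
theorem integral_Ioi_erf_substitution (f : ℝ → ℝ) :
    ∫ x in Ioi 0, f x = 2 / √π * ∫ u, exp (-u ^ 2) / (1 - erf u) * f (log (2 / (1 - erf u))) := by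
  rw [integral_Ioi_substitution_log_two_div_one_sub f,
    integral_erf_substitution (fun y => f (log (2 / (1 - y))) / (1 - y))]
  congr 1
  refine integral_congr_ae (ae_of_all _ fun u => ?_)
  simp only
  ring

/-! ### The double-exponential map `w = exp (u - e^{-u})` (3.4.5.13) -/

/-- The DE map `w(u) = exp (u - e^{-u})` of the whole axis onto `(0, ∞)` for integrands `f₁(x) e^{-x}`.
[cite: DavisRabinowitz1984, Sect. 3.4.5 (3.4.5.13)] -/
def halfLineDEMap (u : ℝ) : ℝ := exp (u - exp (-u))

/-- `w` is positive. [cite: DavisRabinowitz1984, Sect. 3.4.5 (3.4.5.13)] -/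
theorem halfLineDEMap_pos (u : ℝ) : 0 < halfLineDEMap u := exp_pos _

/-- The exponent `u - e^{-u}` has derivative `1 + e^{-u}`. [cite: DavisRabinowitz1984, Sect. 3.4.5 (3.4.5.13)] -/
theorem hasDerivAt_sub_exp_neg (u : ℝ) : HasDerivAt (fun u : ℝ => u - exp (-u)) (1 + exp (-u)) u := by
  have h := (hasDerivAt_id u).sub (hasDerivAt_neg u).exp
  refine h.congr_deriv ?_
  try simp only [id]
  ring

/-- `w'(u) = (1 + e^{-u}) w(u)`. [cite: DavisRabinowitz1984, Sect. 3.4.5 (3.4.5.13)] -/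
theorem hasDerivAt_halfLineDEMap (u : ℝ) :
    HasDerivAt halfLineDEMap ((1 + exp (-u)) * halfLineDEMap u) u := by
  have h := (hasDerivAt_sub_exp_neg u).exp
  refine h.congr_deriv ?_
  simp only [halfLineDEMap]
  ring

/-- The exponent `u - e^{-u}` is a bijection of `ℝ` onto itself: strictly increasing …
[cite: DavisRabinowitz1984, Sect. 3.4.5 (3.4.5.13)] -/
theorem strictMono_sub_exp_neg : StrictMono (fun u : ℝ => u - exp (-u)) :=
  strictMono_of_deriv_pos fun u => by rw [(hasDerivAt_sub_exp_neg u).deriv]; positivity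

/-- … and onto. [cite: DavisRabinowitz1984, Sect. 3.4.5 (3.4.5.13)] -/
theorem surjective_sub_exp_neg : Function.Surjective (fun u : ℝ => u - exp (-u)) := by
  have hcont : Continuous (fun u : ℝ => u - exp (-u)) := by fun_prop
  refine hcont.surjective ?_ ?_
  · refine tendsto_atTop_mono' atTop ?_ (tendsto_atTop_add_const_right atTop (-1:ℝ) tendsto_id)
    filter_upwards [eventually_ge_atTop (0:ℝ)] with u hu
    have : exp (-u) ≤ 1 := exp_le_one_iff.mpr (by linarith)
    simp only [id]
    linarith
  · exact tendsto_atBot_mono (fun u => by have := exp_pos (-u); simp only [id]; linarith) tendsto_id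

/-- `w` is strictly increasing (hence injective). [cite: DavisRabinowitz1984, Sect. 3.4.5 (3.4.5.13)] -/
theorem strictMono_halfLineDEMap : StrictMono halfLineDEMap := exp_strictMono.comp strictMono_sub_exp_neg

/-- `w` maps the whole axis onto `(0, ∞)`. [cite: DavisRabinowitz1984, Sect. 3.4.5 (3.4.5.13)] -/
theorem range_halfLineDEMap : range halfLineDEMap = Ioi 0 := by
  show range (exp ∘ fun u : ℝ => u - exp (-u)) = _
  rw [range_comp, surjective_sub_exp_neg.range_eq, image_univ, range_exp]

/-- **The DE substitution for `f₁(x) e^{-x}` on the half line** (3.4.5.13), `x = w(u) = exp (u - e^{-u})`: for every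
`f`, `∫ x in Ioi 0, f x = ∫ u, (1 + e^{-u}) w(u) f (w u)`. [cite: DavisRabinowitz1984, Sect. 3.4.5 (3.4.5.13)]
[cite: TakahasiMori1974, Sect. 4] -/
theorem integral_Ioi_halfLineDE_substitution (f : ℝ → ℝ) :
    ∫ x in Ioi 0, f x = ∫ u, (1 + exp (-u)) * halfLineDEMap u * f (halfLineDEMap u) := by
  have h := integral_image_eq_integral_abs_deriv_smul (s := (univ : Set ℝ)) (f := halfLineDEMap)
    (f' := fun u => (1 + exp (-u)) * halfLineDEMap u) MeasurableSet.univ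
    (fun u _ => (hasDerivAt_halfLineDEMap u).hasDerivWithinAt) strictMono_halfLineDEMap.injective.injOn f
  rw [image_univ, range_halfLineDEMap, setIntegral_univ] at h
  rw [h]
  refine integral_congr_ae (ae_of_all _ fun u => ?_)
  have : 0 < halfLineDEMap u := halfLineDEMap_pos u
  have : 0 < exp (-u) := exp_pos _
  beta_reduce
  rw [smul_eq_mul, abs_of_pos (by positivity)]

end Literature.MeasureTheory.Integral

end
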